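import Summits.CriticalPhenomena.PercolationContinuityZ3.Theorems.PercNearOneGluingNoHeavyLowerTailFKCSHUnfoldDecoy
import Summits.CriticalPhenomena.PercolationContinuityZ3.Theorems.PercNearOneGluingNoHeavyLowerTailFKCSHPhiNonneg
import Summits.CriticalPhenomena.PercolationContinuityZ3.Theorems.PercNearOneGluingNoHeavyLowerTailFKAnalogues
import Summits.CriticalPhenomena.PercolationContinuityZ3.Theorems.PercNearOneGluingNoHeavyLowerTailCSHUnfoldMain
import Literature.Probability.LatticeModels.RandomClusterEdgeWeightsContinuity
import HarnessLib

/-!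
# FK sub-lane: Lemma U_FK, file 3 — the functional `Φ̃_d` of `Φ_FK` on the edge cluster of a decoy, the accumulated lower-level terms
# `subTFK`, and the sum of the decoy terms along the list (the `Σ_j` of Lemma U for `φ_{w,q}`)

Support / definitions file (`--supports stmt-CriticalPhenomena-4575`), FK sub-lane `prim-bschramm-fk-1` (gen 2) of the post-continuity
programme; builds on p205010 (kernel theorem, internal audit signed; external expert review pending).  No named facts, no sorries; standard
axioms.  Third file of the port plan bschramm/FK-DEFS.md §6.3 (prim-ineq-prove-1's `…NoHeavyLowerTailCSHUnfold.lean` for the random-cluster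
measure).  The monotonicity of `Φ̃_d` is NOT proved here: it is imported as the hypothesis `hΦ : Monotone (FK.phiFK w q x Y g)` — the located
open statement `FK.PhiFKMonotone q` (`…FKCSHPhiDefs.lean`); `Φ̃_d ≥ 0` is `FK.phiFK_nonneg` (`q ≥ 1`).

* `FK.world_cov_eq_wcov` (`'`), `FK.wcov_affine`, `FK.wcov_finset_sum_mul`, `FK.wcov_zero_right`, `FK.wcov_add_right` — dictionary / algebra;
* `FK.phiTFK w q x Y g d K = Φ_FK({d} ∪ V(K))`, `phiTFK_mono` (from `hΦ`), `phiTFK_nonneg`, `phiTFK_openEdgeCluster`, `covDμ_phiTFK_eq`,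
  `avoidConstμ_eq_div`, `sum_ind_avoidEv_ne_zero_rc`, `map_fst_decoyListμ`;
* `FK.subTFK` — the accumulated lower-level terms (`CSH.subT` for `φ_{w,q}`);
* `FK.sum_wcov_unfoldT_rc` — **the `Σ_j` of Lemma U_FK**: the `{x↮Y}`-average of the FK world covariance of `g(C_x)` with the unfolded terms
  is `−subTFK`.
[cite: VandenbergHaggstromKahn2005, §2.1 Lemmas 2.3–2.4 (p. 10) — corollaries] [cite: Grimmett2006, §1.4 eq. (1.20) (p. 15); Thm. (3.1) eq. (3.4)]
-/

noncomputable section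

namespace Summit.CriticalPhenomena.PercolationContinuityZ3.Theorems

open MeasureTheory Set Literature.Probability.LatticeModels Literature.Probability.Percolation
open scoped Classical
open BHK2006 DecisionTree HullPort

namespace FK

variable {V : Type*} [Fintype V]

/-! ### Dictionary: the world covariances of the multi-marker reduction -/

omit [Fintype V] in
/-- World notation: the worlds of Lemma T_rc are `rcMeasureW (delW w (cut Y ω)) q ∅`. [folklore] -/
theorem cutSet_eq_cut (Y : Set V) (ω : BondConfig V) :
    {e : Sym2 V | ∃ z ∈ e, ∃ y ∈ Y, (openGraph ω).Reachable y z} = cut Y ω := rfl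

/-- **The world covariance term of the multi-marker reduction is `FK.wcov`** (measure ↔ sum dictionary for the FK worlds).
[cite: VandenbergHaggstromKahn2005, §2.1 Lemma 2.3 (p. 10)] -/
theorem world_cov_eq_wcov (w : Sym2 V → unitInterval) {q : ℝ} (hq : 0 < q) (Y : Set V) (ω : Set (Sym2 V))
    (G : Set (Sym2 V) → ℝ) (C : Set (Set (Sym2 V))) :
    (∫ η in C, G η ∂(rcMeasureW (delW w {e | ∃ z ∈ e, ∃ y ∈ Y, (openGraph ω).Reachable y z}) q ∅)) -
        (∫ η, G η ∂(rcMeasureW (delW w {e | ∃ z ∈ e, ∃ y ∈ Y, (openGraph ω).Reachable y z}) q ∅)) *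
          (rcMeasureW (delW w {e | ∃ z ∈ e, ∃ y ∈ Y, (openGraph ω).Reachable y z}) q ∅).real C =
      wcov w q Y G (ind C) ω := by
  rw [cutSet_eq_cut, setIntegral_rcMeasureW_eq_sum (delW w (cut Y ω)) hq, integral_rcMeasureW_eq_sum (delW w (cut Y ω)) hq,
    rcMeasureW_real_eq_sum_rcMass (delW w (cut Y ω)) hq]
  unfold wcov wE
  ring


/-- The same with the product in the other order (the shape of the H-part). [cite: VandenbergHaggstromKahn2005, §2.1 Lemma 2.3 (p. 10)] -/
theorem world_cov_eq_wcov' (w : Sym2 V → unitInterval) {q : ℝ} (hq : 0 < q) (Y : Set V) (ω : Set (Sym2 V))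
    (G : Set (Sym2 V) → ℝ) (C : Set (Set (Sym2 V))) :
    (∫ η in C, G η ∂(rcMeasureW (delW w {e | ∃ z ∈ e, ∃ y ∈ Y, (openGraph ω).Reachable y z}) q ∅)) -
        (rcMeasureW (delW w {e | ∃ z ∈ e, ∃ y ∈ Y, (openGraph ω).Reachable y z}) q ∅).real C *
          (∫ η, G η ∂(rcMeasureW (delW w {e | ∃ z ∈ e, ∃ y ∈ Y, (openGraph ω).Reachable y z}) q ∅)) =
      wcov w q Y G (ind C) ω := by
  rw [← world_cov_eq_wcov w hq Y ω G C]; ring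

/-- The world covariance of a general affine combination: `Cov(φ, ψ₁ − p·ψ₂ − (χ₁ − p·χ₂) + K) = Cov(φ,ψ₁) − p·Cov(φ,ψ₂) − Cov(φ,χ₁) + p·Cov(φ,χ₂)`
for a CONSTANT `K` (`q > 0`). [folklore] -/
theorem wcov_affine (w : Sym2 V → unitInterval) {q : ℝ} (hq : 0 < q) (Y : Set V) (φ ψ₁ ψ₂ χ₁ χ₂ : Set (Sym2 V) → ℝ) (p K : ℝ)
    (ω : Set (Sym2 V)) :
    wcov w q Y φ (fun ζ => (ψ₁ ζ - p * ψ₂ ζ) - (χ₁ ζ - p * χ₂ ζ) + K) ω =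
      wcov w q Y φ ψ₁ ω - p * wcov w q Y φ ψ₂ ω - wcov w q Y φ χ₁ ω + p * wcov w q Y φ χ₂ ω := by
  simp only [wcov_eq_sum]
  set B := cut Y ω with hB
  have hm : ∑ η, rcMass (delW w B) q η = 1 := sum_rcMass _ hq
  have h0 : ∑ η, rcMass (delW w B) q η * ((φ η - wE w q B φ) * K) = 0 := by
    have e0 : ∀ η, rcMass (delW w B) q η * ((φ η - wE w q B φ) * K) =
        K * (rcMass (delW w B) q η * φ η) - K * wE w q B φ * rcMass (delW w B) q η := by intro η; ring
    rw [Finset.sum_congr rfl (fun η _ => e0 η), Finset.sum_sub_distrib, ← Finset.mul_sum, ← Finset.mul_sum, hm]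
    unfold wE; ring
  have e : ∀ η, rcMass (delW w B) q η * ((φ η - wE w q B φ) * ((ψ₁ η - p * ψ₂ η) - (χ₁ η - p * χ₂ η) + K)) =
      rcMass (delW w B) q η * ((φ η - wE w q B φ) * ψ₁ η) -
        p * (rcMass (delW w B) q η * ((φ η - wE w q B φ) * ψ₂ η)) -
        rcMass (delW w B) q η * ((φ η - wE w q B φ) * χ₁ η) +
        p * (rcMass (delW w B) q η * ((φ η - wE w q B φ) * χ₂ η)) +
        rcMass (delW w B) q η * ((φ η - wE w q B φ) * K) := by intro η; ring
  rw [Finset.sum_congr rfl (fun η _ => e η), Finset.sum_add_distrib, h0, add_zero, Finset.sum_add_distrib,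
    Finset.sum_sub_distrib, Finset.sum_sub_distrib, ← Finset.mul_sum, ← Finset.mul_sum]

/-- `wcov` pulls finite linear combinations out of the second slot (coefficients first). [folklore] -/
theorem wcov_finset_sum_mul (w : Sym2 V → unitInterval) (q : ℝ) (Y : Set V) (φ : Set (Sym2 V) → ℝ) {ι : Type*} [Fintype ι]
    (a : ι → ℝ) (ψ : ι → Set (Sym2 V) → ℝ) (ω : Set (Sym2 V)) :
    wcov w q Y φ (fun ζ => ∑ i, a i * ψ i ζ) ω = ∑ i, a i * wcov w q Y φ (ψ i) ω := by
  simp only [wcov_eq_sum, Finset.mul_sum]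
  rw [Finset.sum_comm]
  refine Finset.sum_congr rfl fun i _ => ?_
  exact Finset.sum_congr rfl fun η _ => by ring

/-! ### The functional `Φ_FK` on the edge cluster of a decoy -/

/-- **`Φ̃_d(K) = Φ_FK({d} ∪ V(K))`** — the residual functional read on the open EDGE cluster of the decoy `d` (the functional of the
lower-level system with owner `d`; `CSH.phiT` for `φ_{w,q}`). (transcription of the cell memo prim-hp-8 PROOF-S5-ALL-R.md §3.2/§3.5, FK worlds)
[cite: VandenbergHaggstromKahn2005, §2.1 Lemma 2.3 (p. 10)] -/
def phiTFK (w : Sym2 V → unitInterval) (q : ℝ) (x : V) (Y : Set V) (g : Set (Sym2 V) → ℝ) (d : V) (K : Set (Sym2 V)) : ℝ :=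
  phiFK w q x Y g (insert d {u | ∃ e ∈ K, u ∈ e})

/-- `Φ̃_d` is monotone AS SOON AS `Φ_FK` is (the located open statement `FK.PhiFKMonotone q`, here as a hypothesis at the vertex type).
[cite: VandenbergHaggstromKahn2005, §2.1 (pp. 9–13)] -/
theorem phiTFK_mono (w : Sym2 V → unitInterval) (q : ℝ) (x : V) (Y : Set V) (g : Set (Sym2 V) → ℝ)
    (hΦ : Monotone (phiFK w q x Y g)) (d : V) : Monotone (phiTFK w q x Y g d) := fun _ _ hKK' =>
  hΦ (Set.insert_subset_insert fun _ ⟨e, he, hue⟩ => ⟨e, hKK' he, hue⟩)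

/-- `Φ̃_d ≥ 0` for `q ≥ 1` and monotone `g`. [cite: VandenbergHaggstromKahn2005, §2.1 Lemma 2.3 (p. 10)] -/
theorem phiTFK_nonneg (w : Sym2 V → unitInterval) {q : ℝ} (hq : 1 ≤ q) (x : V) (Y : Set V) {g : Set (Sym2 V) → ℝ}
    (hg : Monotone g) (d : V) (K : Set (Sym2 V)) : 0 ≤ phiTFK w q x Y g d K :=
  phiFK_nonneg w hq x Y hg _

/-- `Φ̃_d(C_d(ζ)) = Φ_FK(C_d(ζ))` (vertex cluster). [folklore] -/
theorem phiTFK_openEdgeCluster (w : Sym2 V → unitInterval) (q : ℝ) (x : V) (Y : Set V) (g : Set (Sym2 V) → ℝ) (d : V)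
    (ζ : Set (Sym2 V)) : phiTFK w q x Y g d (openEdgeCluster ζ d) = phiFK w q x Y g (openCluster ζ d) := by
  unfold phiTFK
  rw [← CSH.openCluster_eq_insert_span]

/-- **The denominator-free covariance of the sub-system is the centred decoy moment**: for `E = {d ↮ A}`, `φ = rcMeasureW w q ∅`,
`covDμ φ d A (Φ̃_d)(w') = m₀·P₁(w') − m₁(w')·P₀` (masses and `Φ_FK`-moments at sum level). [folklore] -/
theorem covDμ_phiTFK_eq (w : Sym2 V → unitInterval) {q : ℝ} (hq : 0 < q) (x : V) (Y A : Set V) (g : Set (Sym2 V) → ℝ) (d w' : V) :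
    covDμ (rcMeasureW w q ∅) d A (phiTFK w q x Y g d) w' =
      (∑ ζ, rcMass w q ζ * ind (avoidEv d A) ζ) *
          (∑ ζ, rcMass w q ζ * (ind (avoidEv d A ∩ openConn d w') ζ * phiFK w q x Y g (openCluster ζ d))) -
        (∑ ζ, rcMass w q ζ * ind (avoidEv d A ∩ openConn d w') ζ) *
          (∑ ζ, rcMass w q ζ * (ind (avoidEv d A) ζ * phiFK w q x Y g (openCluster ζ d))) := by
  unfold covDμ
  rw [rcMeasureW_real_eq_sum_rcMass w hq, rcMeasureW_real_eq_sum_rcMass w hq, setIntegral_rcMeasureW_eq_sum w hq,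
    setIntegral_rcMeasureW_eq_sum w hq]
  simp only [phiTFK_openEdgeCluster]
  have hE : ({ω : BondConfig V | ∀ y ∈ A, ¬ (openGraph ω).Reachable d y} : Set (Set (Sym2 V))) = avoidEv d A := rfl
  rw [hE]
  have e1 : ∀ ζ, rcMass w q ζ * (phiFK w q x Y g (openCluster ζ d) * ind (avoidEv d A ∩ openConn d w') ζ) =
      rcMass w q ζ * (ind (avoidEv d A ∩ openConn d w') ζ * phiFK w q x Y g (openCluster ζ d)) := fun ζ => by ring
  have e2 : ∀ ζ, rcMass w q ζ * (phiFK w q x Y g (openCluster ζ d) * ind (avoidEv d A) ζ) =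
      rcMass w q ζ * (ind (avoidEv d A) ζ * phiFK w q x Y g (openCluster ζ d)) := fun ζ => by ring
  rw [Finset.sum_congr rfl fun ζ _ => e1 ζ, Finset.sum_congr rfl fun ζ _ => e2 ζ]
  ring

/-- **The decoy constant is the ratio of masses** (sum level). [folklore] -/
theorem avoidConstμ_eq_div (w : Sym2 V → unitInterval) {q : ℝ} (hq : 0 < q) (d : V) (A : Set V) (w' : V) :
    avoidConstμ (rcMeasureW w q ∅) d A w' = (∑ ζ, rcMass w q ζ * ind (avoidEv d A ∩ openConn d w') ζ) /
      ∑ ζ, rcMass w q ζ * ind (avoidEv d A) ζ := by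
  unfold avoidConstμ
  rw [rcMeasureW_real_eq_sum_rcMass w hq, rcMeasureW_real_eq_sum_rcMass w hq]
  rfl

/-- For non-degenerate parameters and `d ∉ A`, `φ(d ↮ A) = Σ_ζ m 1{d↮A} ≠ 0`. [cite: Grimmett2006, Thm. (3.1) eq. (3.4) (finite energy)] -/
theorem sum_ind_avoidEv_ne_zero_rc (w : Sym2 V → unitInterval) {q : ℝ} (hq : 0 < q) (hw : ∀ e, 0 < w e ∧ w e < 1) {d : V}
    {A : Set V} (hdA : d ∉ A) : ∑ ζ, rcMass w q ζ * ind (avoidEv d A) ζ ≠ 0 := by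
  rw [← rcMeasureW_real_eq_sum_rcMass w hq]
  have hmem : (∅ : Set (Sym2 V)) ∈ avoidEv d A := by
    intro a ha hreach
    have hbot : openGraph (∅ : BondConfig V) = ⊥ := by
      unfold openGraph; exact SimpleGraph.fromEdgeSet_empty
    rw [hbot, SimpleGraph.reachable_bot] at hreach
    exact hdA (hreach ▸ ha)
  exact (rcMeasureW_real_pos_of_nonempty hq hw ∅ ⟨∅, hmem⟩).ne'

omit [Fintype V] in
/-- The decoys of `decoyListμ μ A D` are, in order, `D`. [folklore] -/
theorem map_fst_decoyListμ (μ : Measure (BondConfig V)) (A : Set V) (D : List V) :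
    (decoyListμ μ A D).map Prod.fst = D := by
  induction D generalizing A with
  | nil => rfl
  | cons d ds ih => simpa [decoyListμ] using ih (insert d A)

/-! ### Summing the decoy terms along the list (the `Σ_j` of Lemma U_FK) -/

/-- The accumulated lower-level terms of the FK unfolding at the marker `u` (recursion along the decoy list with a growing source set;
`CSH.subT` for `φ_{w,q}` with the functional `Φ̃_d` of `Φ_FK`). (transcription of the cell memo prim-hp-8 PROOF-S5-ALL-R.md §3.3, FK worlds) [folklore] -/
def subTFK (w : Sym2 V → unitInterval) (q : ℝ) (x : V) (Y : Set V) (g : Set (Sym2 V) → ℝ) (u : V) : Set V → List V → ℝ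
  | _, [] => 0
  | S, d :: ds => ((rcMeasureW w q ∅).real (avoidEv d (S ∪ Y)))⁻¹ *
        CSH.slForm (decoyListμ (rcMeasureW w q ∅) (insert d (S ∪ Y)) ds)
          (covDμ (rcMeasureW w q ∅) d (S ∪ Y) (phiTFK w q x Y g d)) u +
      subTFK w q x Y g u (insert d S) ds

/-- The world covariance vanishes on the zero test function. [folklore] -/
theorem wcov_zero_right (w : Sym2 V → unitInterval) (q : ℝ) (Y : Set V) (φ : Set (Sym2 V) → ℝ) (ω : Set (Sym2 V)) :
    wcov w q Y φ (fun _ => 0) ω = 0 := by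
  rw [wcov_eq_sum]; simp

/-- The world covariance is additive in the test function. [folklore] -/
theorem wcov_add_right (w : Sym2 V → unitInterval) (q : ℝ) (Y : Set V) (φ ψ₁ ψ₂ : Set (Sym2 V) → ℝ) (ω : Set (Sym2 V)) :
    wcov w q Y φ (fun ζ => ψ₁ ζ + ψ₂ ζ) ω = wcov w q Y φ ψ₁ ω + wcov w q Y φ ψ₂ ω := by
  simp only [wcov_eq_sum, ← Finset.sum_add_distrib]
  exact Finset.sum_congr rfl fun η _ => by ring

/-- **The `Σ_j` of Lemma U for `φ_{w,q}`**: the `{x↮Y}`-average of the world covariance of `g(C_x)` with the unfolded terms `unfoldT` (read in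
the world) is MINUS the accumulated lower-level terms `subTFK` (`CSH.sum_wcov_unfoldT` for the random-cluster measure).
[cite: VandenbergHaggstromKahn2005, §2.1 Lemmas 2.3–2.4 (p. 10) — corollary] -/
theorem sum_wcov_unfoldT_rc (w : Sym2 V → unitInterval) {q : ℝ} (hq : 0 < q) (hw : ∀ e, 0 < w e ∧ w e < 1) (x : V) (Y : Set V)
    (g : Set (Sym2 V) → ℝ) (u : V) :
    ∀ (D : List V) (S : Set V), x ∈ S → D.Nodup → (∀ d ∈ D, d ∉ S ∧ d ∉ Y ∧ d ≠ u) →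
      ∑ ω, rcMass w q ω * (ind (avoidEv x Y) ω *
          wcov w q Y (fun β => g (openEdgeCluster β x))
            (fun ζ => CSH.unfoldT (openGraph ζ).Reachable S (decoyListμ (rcMeasureW w q ∅) (S ∪ Y) D) u) ω) =
        - subTFK w q x Y g u S D := by
  intro D
  induction D with
  | nil =>
    intro S _ _ _
    have h0 : (fun ζ : Set (Sym2 V) => CSH.unfoldT (openGraph ζ).Reachable S (decoyListμ (rcMeasureW w q ∅) (S ∪ Y) []) u) =
        fun _ => 0 := by
      funext ζ; simp [decoyListμ, CSH.unfoldT]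
    rw [h0]
    simp only [subTFK, neg_zero]
    exact Finset.sum_eq_zero fun ω _ => by rw [wcov_zero_right]; ring
  | cons d ds ih =>
    intro S hxS hnd hdis
    set φm := rcMeasureW w q ∅ with hφm
    have hdS : d ∉ S := (hdis d List.mem_cons_self).1
    have hdY : d ∉ Y := (hdis d List.mem_cons_self).2.1
    have hud : u ≠ d := fun h => (hdis d List.mem_cons_self).2.2 h.symm
    have hnd' : ds.Nodup := (List.nodup_cons.1 hnd).2
    have hd_notin : d ∉ ds := (List.nodup_cons.1 hnd).1
    have hL : decoyListμ φm (S ∪ Y) (d :: ds) = (d, avoidConstμ φm d (S ∪ Y)) :: decoyListμ φm (insert d (S ∪ Y)) ds := rfl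
    have hset : insert d (S ∪ Y) = insert d S ∪ Y := by rw [Set.insert_union]
    have hL' : ∀ dc ∈ decoyListμ φm (insert d (S ∪ Y)) ds, dc.1 ≠ d := by
      intro dc hdc hEq
      have : dc.1 ∈ (decoyListμ φm (insert d (S ∪ Y)) ds).map Prod.fst := List.mem_map.2 ⟨dc, hdc, rfl⟩
      rw [map_fst_decoyListμ, hEq] at this
      exact hd_notin this
    have hm₀ : ∑ ζ, rcMass w q ζ * ind (avoidEv d (S ∪ Y)) ζ ≠ 0 :=
      sum_ind_avoidEv_ne_zero_rc w hq hw (fun h => h.elim hdS hdY)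
    have hsplit : ∀ ω, wcov w q Y (fun β => g (openEdgeCluster β x))
        (fun ζ => CSH.unfoldT (openGraph ζ).Reachable S (decoyListμ φm (S ∪ Y) (d :: ds)) u) ω =
        wcov w q Y (fun β => g (openEdgeCluster β x))
          (fun ζ => CSH.av (openGraph ζ).Reachable S d *
            CSH.slForm (decoyListμ φm (insert d (S ∪ Y)) ds)
              (fun w' => CSH.chi (openGraph ζ).Reachable w' d - avoidConstμ φm d (S ∪ Y) w') u) ω +
        wcov w q Y (fun β => g (openEdgeCluster β x))
          (fun ζ => CSH.unfoldT (openGraph ζ).Reachable (insert d S) (decoyListμ φm (insert d S ∪ Y) ds) u) ω := by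
      intro ω
      rw [← wcov_add_right, hL]
      simp only [CSH.unfoldT, hset]
    have hhead := decoy_world_term_rc w hq x Y g hxS hdS (decoyListμ φm (insert d (S ∪ Y)) ds) hL' hud
      (avoidConstμ φm d (S ∪ Y)) hm₀ (fun w' => avoidConstμ_eq_div w hq d (S ∪ Y) w')
    have hQ : (fun w' =>
        (∑ ζ, rcMass w q ζ * ind (avoidEv d (S ∪ Y)) ζ) *
            (∑ ζ, rcMass w q ζ * (ind (avoidEv d (S ∪ Y) ∩ openConn d w') ζ * phiFK w q x Y g (openCluster ζ d))) -
          (∑ ζ, rcMass w q ζ * ind (avoidEv d (S ∪ Y) ∩ openConn d w') ζ) *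
            (∑ ζ, rcMass w q ζ * (ind (avoidEv d (S ∪ Y)) ζ * phiFK w q x Y g (openCluster ζ d)))) =
        covDμ φm d (S ∪ Y) (phiTFK w q x Y g d) := by
      funext w'; rw [covDμ_phiTFK_eq w hq]
    rw [hQ, ← rcMeasureW_real_eq_sum_rcMass w hq] at hhead
    have htail := ih (insert d S) (Set.mem_insert_of_mem d hxS) hnd' (fun e he =>
      ⟨fun h' => (Set.mem_insert_iff.1 h').elim (fun h0 => hd_notin (h0 ▸ he)) (hdis e (List.mem_cons_of_mem d he)).1,
        (hdis e (List.mem_cons_of_mem d he)).2.1, (hdis e (List.mem_cons_of_mem d he)).2.2⟩)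
    have e : ∀ ω, rcMass w q ω * (ind (avoidEv x Y) ω * wcov w q Y (fun β => g (openEdgeCluster β x))
        (fun ζ => CSH.unfoldT (openGraph ζ).Reachable S (decoyListμ φm (S ∪ Y) (d :: ds)) u) ω) =
        rcMass w q ω * (ind (avoidEv x Y) ω * wcov w q Y (fun β => g (openEdgeCluster β x))
          (fun ζ => CSH.av (openGraph ζ).Reachable S d *
            CSH.slForm (decoyListμ φm (insert d (S ∪ Y)) ds)
              (fun w' => CSH.chi (openGraph ζ).Reachable w' d - avoidConstμ φm d (S ∪ Y) w') u) ω) +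
        rcMass w q ω * (ind (avoidEv x Y) ω * wcov w q Y (fun β => g (openEdgeCluster β x))
          (fun ζ => CSH.unfoldT (openGraph ζ).Reachable (insert d S) (decoyListμ φm (insert d S ∪ Y) ds) u) ω) := by
      intro ω; rw [hsplit]; ring
    rw [Finset.sum_congr rfl (fun ω _ => e ω), Finset.sum_add_distrib, hhead, htail]
    simp only [subTFK, hset]
    ring

end FK

end Summit.CriticalPhenomena.PercolationContinuityZ3.Theorems

end
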